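import Mathlib
import Summits.Ventures.HodgeRepro.Tier4.Line4.StabilityOfProjected
import Summits.Ventures.HodgeRepro.Tier4.Line4.ProjPlane
import Summits.Ventures.HodgeRepro.Tier4.Common.TestProjectorVanishing
import Summits.Ventures.HodgeRepro.Tier4.Common.CompactHaarProbability
import Summits.Ventures.HodgeRepro.Tier4.Common.RowWeights

/-!
# Tier4/Line4/ProjDataSeesaw — the displayed inputs of the `(τ′,K)`-projector DISCHARGED on the seesaw plane: every
datum of `projData` is good and `hnorm` holds, from the plane's own binders (modulo the compactness of the local tori
of `T′`, typer-2's LocalTorusCompact transport, DISPLAYED here as `hcompT`)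

Blind re-derivation cell `pub-hodge-repro`, Tier 4 «prove the step» (README §9–§10), seat t4-L4-p2 (prover, LINE L4,
gen 3; the `hgood` / `hnorm` binders of v0.26's example (xi), plan-4 S14047). Tree path
`lean/Summits/Ventures/HodgeRepro/Tier4/Line4/ProjDataSeesaw.lean`. Mathlib-level; no literature. Inputs: this seat's
`Line4/StabilityOfProjected` (`projData`, `ProjDatum.Good`), typer-2's `Line4/ProjPlane`
(`localTorusAt'_withTransportedTorus_conj`, `adMat_mul_adMat_eq_one`), `Common/TestProjectorVanishing`
(`weightChar'_mul_of_conj`, `norm_weightChar'_eq_one_of_conj`, `norm_weightAt'_eq_one_of_conj`),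
`Common/CompactHaarProbability` (`haarProb`), `Common/RowWeights` (`IsCMAt`, `continuous_adToC`).

* `continuous_entryAtConj`, `continuous_weightAt'` — the transported weights are continuous on `G(𝔸_k)`;
* `continuous_weightChar'_localTorusAt'` — the product character is continuous on the local torus of `T′` (the
  weights are units there);
* `seesawNu hcompT w := haarProb (localTorusAt' W′ w)` — the normalised Haar measure of each local torus, given its
  compactness; `seesawNuK hK := haarProb K`;
* **`good_projData_seesaw`**: on `W′ := (mixedRow q (a 0) (a 2)).withTransportedTorus g g' …` (the skeleton's
  `seesawPlane`), with `a 1 ≠ 0`, `a 3 ≠ 0`, the similitude `_hiso` (`λ ≠ 0`), every infinite place REAL with the CM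
  inequality `IsCMAt q w` (`t_w² < 4 n_w`), the compactness `hcompT` of the local tori of `T′`, and a compact open level
  `K ≤ finitePart W′`: EVERY datum of `projData W′ q g g' eP' eM' (seesawNu …) K (seesawNuK …)` is good; and
  **`hnorm_seesaw`**: the line weights of `T′` have modulus one on the local tori — the binder `hnorm` of
  `ConjStability`.
So example (xi)'s `hgood`, `hcomm` (`pairwise_projData` with `hK.le`) and `hnorm` are by name once `hcompT` is
(typer-2's LocalTorusCompact + its transport along `g`, S14041).

Nothing here says anything about the status of the Hodge conjecture for CM abelian varieties, which is NOT proved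
(HC_CM is NOT proved by anyone in this repository).
-/

set_option autoImplicit false

noncomputable section

namespace Summit.Ventures.HodgeRepro.Tier4.Line4

open Summit.Ventures.HodgeRepro.Tier4.Common Summit.Ventures.HodgeRepro.Tier4.Line1 MeasureTheory NumberField
  Matrix
open scoped ComplexConjugate

section Continuity

variable {k : Type} [Field k] [NumberField k] (W : PlaneData k)

/-- The `w`-component of an adele is continuous. -/
theorem continuous_adComponentInf (w : InfinitePlace k) : Continuous (adComponentInf k w) :=
  (continuous_apply w).comp continuous_fst

/-- The entries of the `w`-component of `κ ∈ G(𝔸_k)` are continuous. -/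
theorem continuous_infiniteComponent_entry (w : InfinitePlace k) (i j : Fin 4) :
    Continuous fun κ : GA W =>
      ((GA.infiniteComponent W w κ : GL (Fin 4) w.Completion) : Matrix (Fin 4) (Fin 4) w.Completion) i j :=
  (continuous_adComponentInf w).comp (continuous_mat_entry W i j)

/-- **The conjugated entries `entryAtConj` are continuous in `κ`.** -/
theorem continuous_entryAtConj (w : InfinitePlace k) (g g' : Matrix (Fin 4) (Fin 4) k) (i j : Fin 4) :
    Continuous fun κ : GA W => entryAtConj W w g g' κ i j := by
  unfold entryAtConj
  refine (InfinitePlace.Completion.isometry_extensionEmbedding w).continuous.comp ?_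
  simp only [Matrix.mul_apply]
  refine continuous_finsetSum _ fun l _ => ?_
  refine Continuous.mul (continuous_finsetSum _ fun m _ => ?_) continuous_const
  exact continuous_const.mul (continuous_infiniteComponent_entry W w m l)

/-- **The transported weights `weightAt'` are continuous in `κ`.** -/
theorem continuous_weightAt' (q : QuadData k) (w : InfinitePlace k) (g g' : Matrix (Fin 4) (Fin 4) k) (j : Fin 2) :
    Continuous fun κ : GA W => weightAt' W q w g g' j κ :=
  (continuous_entryAtConj W w g g' _ _).add ((continuous_entryAtConj W w g g' _ _).mul continuous_const)

/-- The product character `weightChar'` is continuous on the local torus of `T′` when the weights are units there. -/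
theorem continuous_weightChar'_localTorusAt' (q : QuadData k) (g g' : Matrix (Fin 4) (Fin 4) k)
    (eP' eM' : InfinitePlace k → ℤ) (w : InfinitePlace k)
    (hnorm : ∀ κ ∈ localTorusAt' W w, ∀ j : Fin 2, ‖weightAt' W q w g g' j κ‖ = 1) :
    Continuous fun κ : localTorusAt' W w => weightChar' W q g g' eP' eM' w κ := by
  have h0 : Continuous fun κ : localTorusAt' W w => weightAt' W q w g g' 0 κ :=
    (continuous_weightAt' W q w g g' 0).comp continuous_subtype_val
  have h1 : Continuous fun κ : localTorusAt' W w => weightAt' W q w g g' 1 κ :=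
    (continuous_weightAt' W q w g g' 1).comp continuous_subtype_val
  have hne : ∀ (j : Fin 2) (κ : localTorusAt' W w), weightAt' W q w g g' j κ ≠ 0 := fun j κ => by
    intro h
    have := hnorm κ κ.2 j
    rw [h, norm_zero] at this
    exact zero_ne_one this
  exact (h0.zpow₀ (eP' w) fun κ => Or.inl (hne 0 κ)).mul (h1.zpow₀ (eM' w) fun κ => Or.inl (hne 1 κ))

end Continuity

section Seesaw

variable {k : Type} [Field k] [NumberField k] (q : QuadData k) (a : Fin 4 → k)
  (g g' : Matrix (Fin 4) (Fin 4) k) (hgg' : g * g' = 1) (hg'g : g' * g = 1)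
  (hgΩ : g * (PlaneData.mixedRow q (a 0) (a 2)).Ω = (PlaneData.mixedRow q (a 0) (a 2)).Ω * g)

/-- The seesaw plane of L4 (the skeleton's `seesawPlane`, spelled out). -/
abbrev seesawOf : PlaneData k := (PlaneData.mixedRow q (a 0) (a 2)).withTransportedTorus g g' hgg' hg'g hgΩ

variable [MeasurableSpace (GA (seesawOf q a g g' hgg' hg'g hgΩ))] [BorelSpace (GA (seesawOf q a g g' hgg' hg'g hgΩ))]

omit [MeasurableSpace (GA (seesawOf q a g g' hgg' hg'g hgΩ))] [BorelSpace (GA (seesawOf q a g g' hgg' hg'g hgΩ))] in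
/-- **`hnorm` on the seesaw plane**: the line weights of `T′` have modulus one on the local tori of `T′`
(`a 1 ≠ 0`, `a 3 ≠ 0`, the similitude, every infinite place real with the CM inequality). -/
theorem hnorm_seesaw (ha1 : a 1 ≠ 0) (ha3 : a 3 ≠ 0) (lam : k) (hlam : lam ≠ 0)
    (hiso : g * (PlaneData.mixedRow q (a 1) (a 3)).B * gᵀ = lam • (PlaneData.mixedRow q (a 0) (a 2)).B)
    (hreal : ∀ w : InfinitePlace k, w.IsReal) (hcm : ∀ w : InfinitePlace k, IsCMAt q w) :
    ∀ (w : InfinitePlace k) (κ : GA (seesawOf q a g g' hgg' hg'g hgΩ)),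
      κ ∈ localTorusAt' (seesawOf q a g g' hgg' hg'g hgΩ) w →
      ∀ j : Fin 2, ‖weightAt' (seesawOf q a g g' hgg' hg'g hgΩ) q w g g' j κ‖ = 1 :=
  fun w κ hκ j =>
    norm_weightAt'_eq_one_of_conj q (a 1) (a 3) (-1) w ha1 ha3 (by norm_num) (hreal w) (hcm w) _ g g' w
      (localTorusAt'_withTransportedTorus_conj q a g g' hgg' hg'g hgΩ lam hlam hiso w) j κ hκ

/-- The normalised Haar measure of the local torus of `T′` at `w`, given its compactness. -/
def seesawNu (hcompT : ∀ w : InfinitePlace k,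
      IsCompact (localTorusAt' (seesawOf q a g g' hgg' hg'g hgΩ) w : Set (GA (seesawOf q a g g' hgg' hg'g hgΩ))))
    (w : InfinitePlace k) : Measure (localTorusAt' (seesawOf q a g g' hgg' hg'g hgΩ) w) :=
  @haarProb _ _ _ _ (compactSpace_subgroup_of_isCompact _ (hcompT w)) _ _

/-- The normalised Haar measure of a compact open level `K`. -/
def seesawNuK (K : Subgroup (GA (seesawOf q a g g' hgg' hg'g hgΩ)))
    (hK : IsCompact (K : Set (GA (seesawOf q a g g' hgg' hg'g hgΩ)))) : Measure K :=
  @haarProb _ _ _ _ (compactSpace_subgroup_of_isCompact _ hK) _ _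

/-- **Every datum of the seesaw plane's projector is good**: from `a 1 ≠ 0`, `a 3 ≠ 0`, the similitude, the real CM
places, the compactness of the local tori of `T′` (`hcompT`) and the compactness of the level. -/
theorem good_projData_seesaw (ha1 : a 1 ≠ 0) (ha3 : a 3 ≠ 0) (lam : k) (hlam : lam ≠ 0)
    (hiso : g * (PlaneData.mixedRow q (a 1) (a 3)).B * gᵀ = lam • (PlaneData.mixedRow q (a 0) (a 2)).B)
    (hreal : ∀ w : InfinitePlace k, w.IsReal) (hcm : ∀ w : InfinitePlace k, IsCMAt q w)
    (hcompT : ∀ w : InfinitePlace k,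
      IsCompact (localTorusAt' (seesawOf q a g g' hgg' hg'g hgΩ) w : Set (GA (seesawOf q a g g' hgg' hg'g hgΩ))))
    (K : Subgroup (GA (seesawOf q a g g' hgg' hg'g hgΩ)))
    (hKc : IsCompact (K : Set (GA (seesawOf q a g g' hgg' hg'g hgΩ)))) (eP' eM' : InfinitePlace k → ℤ) :
    ∀ d ∈ projData (seesawOf q a g g' hgg' hg'g hgΩ) q g g' eP' eM' (seesawNu q a g g' hgg' hg'g hgΩ hcompT) K
      (seesawNuK q a g g' hgg' hg'g hgΩ K hKc), d.Good := by
  have hnorm := hnorm_seesaw q a g g' hgg' hg'g hgΩ ha1 ha3 lam hlam hiso hreal hcm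
  refine good_projData _ q g g' eP' eM' _ K _ hcompT (fun w => ?_) (fun w => ?_) (fun w => ?_) (fun w => ?_)
    (fun w => ?_) hKc ?_ ?_
  · haveI : CompactSpace (localTorusAt' (seesawOf q a g g' hgg' hg'g hgΩ) w) :=
      compactSpace_subgroup_of_isCompact _ (hcompT w)
    haveI : IsProbabilityMeasure (seesawNu q a g g' hgg' hg'g hgΩ hcompT w) := isProbabilityMeasure_haarProb _
    exact inferInstance
  · haveI : CompactSpace (localTorusAt' (seesawOf q a g g' hgg' hg'g hgΩ) w) :=
      compactSpace_subgroup_of_isCompact _ (hcompT w)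
    have h : (seesawNu q a g g' hgg' hg'g hgΩ hcompT w).IsHaarMeasure := isHaarMeasure_haarProb _
    exact h.toIsMulLeftInvariant
  · exact continuous_weightChar'_localTorusAt' _ q g g' eP' eM' w (fun κ hκ j => hnorm w κ hκ j)
  · intro x hx y hy
    exact weightChar'_mul_of_conj q (a 1) (a 3) (-1) w ha1 ha3 (by norm_num) (hreal w) (hcm w) _ g g'
      (adMat_mul_adMat_eq_one g g' hgg') w
      (localTorusAt'_withTransportedTorus_conj q a g g' hgg' hg'g hgΩ lam hlam hiso w) (eP' w) (eM' w) x hx y hy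
  · intro x hx
    exact norm_weightChar'_eq_one_of_conj q (a 1) (a 3) (-1) w ha1 ha3 (by norm_num) (hreal w) (hcm w) _ g g' w
      (localTorusAt'_withTransportedTorus_conj q a g g' hgg' hg'g hgΩ lam hlam hiso w) (eP' w) (eM' w) x hx
  · haveI : CompactSpace K := compactSpace_subgroup_of_isCompact _ hKc
    haveI : IsProbabilityMeasure (seesawNuK q a g g' hgg' hg'g hgΩ K hKc) := isProbabilityMeasure_haarProb _
    exact inferInstance
  · haveI : CompactSpace K := compactSpace_subgroup_of_isCompact _ hKc
    have h : (seesawNuK q a g g' hgg' hg'g hgΩ K hKc).IsHaarMeasure := isHaarMeasure_haarProb _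
    exact h.toIsMulLeftInvariant

end Seesaw

end Summit.Ventures.HodgeRepro.Tier4.Line4

end
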